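import Mathlib
import HarnessLib
import HarnessLib.Audit
import Summits.Langlands.Langlands.Theorems.TwoDivisionFieldSplit
import Literature.NumberTheory.Automorphic.FreitasLeHungSiksekLifting
import Literature.NumberTheory.Automorphic.FLSResidualImageCartanNormalizer

/-!
# OddPrimeDoorSplit (Prelude: §1–§3 dials, junctions, pieces) — lens-5 g30 node on RES = `DyadicDoorSplit.DyadicDegenerateResidual` (and on its four g29 pieces)

TARGET (tree decl, BY NAME): RES = `Summit.Langlands.Langlands.Theorems.DyadicDoorSplit.DyadicDegenerateResidual`
(g28, `Theorems/DyadicDoorSplitPrelude.lean`): every integral `E` (`Δ ≠ 0`) over an UNANCHORED totally real field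
`K₀` of degree `≥ 6` (`DepthIsolationSplit.UnanchoredBox K₀`), of residual moduli degree
(`JDegreeFilterSplit.InResidualRange K₀ E`), OFF the Allen locus, is modular.  Lineage: REST (stmt-Langlands-26998)
→ REST_E (g26) → LJR (g27) → ADS ∧ RES (g28) → F2T ∧ R₂⁻ ∧ R_ss⁻ ∧ R_cm⁶ (g29, `TwoDivisionFieldSplit`, prime `2`
exhausted: on the whole 2-degenerate residual `ρ̄_{E,2}` is reducible and no printed theorem applies).

THESIS OF THE CUT (lens 5 «finite/base range + asymptotic regime + bridge», read at the ODD torsion primes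
`p ∈ {3, 5, 7}` — the primes at which printed modularity lifting needs no hypothesis on the totally real field):
* GENERIC REGIME (door 1, CLOSED BY NAME): `Generic357 K₀ E` — for some `p ∈ {3,5,7}` the image
  `ρ̄_{E,p}(G_{K₀(ζ_p)})` is absolutely irreducible (tree carrier `ModPImageAbsIrreducibleOverCyclotomic`).
  Freitas–Le Hung–Siksek 2015, Thms. 3–4 (tree NAMED FACT `FLS2015_theorems3_4`, stated for EVERY totally real
  field; `FLS2015_theorems3_4.isModularEllipticCurve`) decide modularity there: `genericSector_closed`.
* FINITE RANGE: off door 1, for EACH `p ∈ {3,5,7}` some framing of `E[p]` is Borel-, split-Cartan-normaliser- or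
  non-split-Cartan-normaliser-valued (tree theorem `FLS2015.levelStructure_of_not_modPImageAbsIrreducibleOverCyclotomic`,
  re-exported on the dial as `levelStructures_of_not_generic`; at `p = 3` sharpened by the PROVED Prop. 9.1 (a):
  reducible or image `= C_s⁺(3)`, `mod3_dichotomy_of_not_generic`) — i.e. `j(E)` is a `K₀`-point of one of the
  27 curves `X(u,v,w)` of FLS §7 (finitely many `j` per field by Faltings; ineffective, hence NOT a closing).
* BRIDGE (door 2, a PRINT CHAIN not yet in the tree, typed E-level and model-invariantly as ONE junction
  `SkinnerWilesDihedralDoor`): on the sub-locus `SWLocus K₀ E p` — `ρ̄_{E,p}` absolutely irreducible for every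
  framing, NOT generic at `p` (so `ρ̄_{E,p}` is induced from the quadratic subfield of `K₀(ζ_p)/K₀`: dihedral),
  `v(j) < 0` at every `v ∣ p` (potentially multiplicative, hence `ρ_{E,p}|_{D_v} ≃ (τε *; 0 τ)` nearly ordinary with
  `τ` quadratic) and `μ_p ⊄ K₀ᵥ` at every `v ∣ p` (so `ε̄ ≠ 1` on `D_v`: `ρ̄` is `D_v`-distinguished) —
  Skinner–Wiles 2001 (Ann. Fac. Sci. Toulouse (6) 10, Thm. 5.1, p. 204: `F` ANY totally real field, `p` odd,
  no Taylor–Wiles hypothesis) + a `χ₂`-good nearly-ordinary automorphic lift of `ρ̄` (theta series of the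
  inducing character and its ordinary Hida-family members of weight `≥ 2`: Hecke / Jacquet–Langlands, Wiles 1988,
  Hida 1989) give modularity: `swSector_closed`.
* BRIDGE' (door 3, a PRINT CHAIN not yet in the tree, ONE junction `PanZhangSupersingularDoor`): on the sub-locus
  `PZLocus K₀ E p` — `p` TOTALLY SPLIT in `K₀` (`K₀ᵥ = ℚ_p`), `ρ̄_{E,p}` absolutely irreducible for every framing,
  `v(j − j_ss(p)) > 0` at every `v ∣ p` (potentially supersingular, so `ρ_{E,p}|_{G_{ℚ_p}}` is absolutely
  irreducible) — X. Zhang 2024, Thm. 6.1.1 (arXiv:2412.06812 p. 33, after L. Pan 2022: `p` odd completely split in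
  `F`, NO hypothesis on `ρ̄|G_{F(ζ_p)}`) + residual automorphy of the (generic or dihedral) `ρ̄_{E,p}` give
  modularity: `pzSector_closed`.  (This is the cell-lineage, E-level form of the two printed doors used ρ-level at
  `p = 3` on the host's `C_s⁺(3)` crux by the line `Cruxes/SplitCartanThreeAutomorphic/Lines/threelocal`.)
* RESIDUAL (declared, IDEA-NEEDED): `CoreResidual` = RES restricted to `OffDoors K₀ E` (no door), and the
  same restriction `…Core` of each g29 piece.  EXACTNESS: `residual_iff_core`, `fullTwoTorsion_iff_core`, … .

KERNEL THEOREMS (no `sorry`): pointwise `modular_of_offDoors` (FLS34 → SWD → PZD → (OffDoors → modular) → modular);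
RES ⟸ FLS34 ∧ SWD ∧ PZD ∧ CoreResidual (`residual_of_core`) and RES ⟹ CoreResidual (`core_of_residual`); the same for
F2T, R₂⁻, R_ss⁻, R_cm⁶; the finite-range certificates; compositions BY NAME up to LJR (`largeJResidual_of_core`,
through g28's `largeJResidual_of_sectors`), REST_E (`restE_of_core`) and REST = stmt-Langlands-26998
(`closes_target`, `closes_byName`, through `JDegreeFilterSplit.closes_target`); necessity `core_of_largeJResidual`,
`core_of_restE`.  No `instance`, no `notation`; every dial is a property of `j(E)`, of the Galois module `E[p]`
or of the field `K₀` (model-invariant).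

References: [FreitasLeHungSiksek2015] arXiv:1310.7088, Thms. 3, 4 (p. 4), Prop. 3.1, Prop. 9.1 (a), §7;
[SkinnerWiles2001] C. Skinner, A. Wiles, *Nearly ordinary deformations of irreducible residual representations*,
Ann. Fac. Sci. Toulouse Math. (6) 10 (2001) 185–215, doi:10.5802/afst.988, (5.1) p. 203 and Thm. 5.1 p. 204;
[Allen2014] arXiv:1301.1113 p. 3 (SW removed the Taylor–Wiles hypothesis in the ordinary case); [Thorne2016]
arXiv:1504.00994, p. 3; [Wiles1988] Invent. Math. 94, 529–573; [Hida1989] nearly ordinary Hecke algebras over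
totally real fields; [XZhang2024] X. Zhang, *On the Fontaine–Mazur conjecture for p = 3*, arXiv:2412.06812, Thm. 6.1.1
(p. 33) and Remark 6.1.2; [Pan2022] L. Pan, *The Fontaine–Mazur conjecture in the residually reducible case*,
J. Amer. Math. Soc. 35 (2022), arXiv:1901.07166, Thms. 1.0.2, 1.0.4.
-/

set_option linter.dupNamespace false
set_option linter.unusedVariables false

open scoped NumberField IntermediateField ComplexConjugate MatrixGroups
open NumberField IsDedekindDomain Field Literature.NumberTheory.Automorphic
open Literature.NumberTheory.GaloisRepresentations
open Summit.Langlands.Langlands.Theorems.DepthIsolationSplit (UnanchoredBox UnanchoredHighDegreeModularE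
  IntegralModelTransferPointwise SatakeAvatarTwo satakeAvatarTwo_of_host)
open Summit.Langlands.Langlands.Theorems.JDegreeFilterSplit (jInv jDeg InResidualRange LargeJResidual
  RatBaseChangeModularity SmallFieldBaseChange SolvableDescentModularity restE_of_jLeaves largeJResidual_of_restE)
open Summit.Langlands.Langlands.Theorems.DyadicDoorSplit (disc NoRationalTwoTorsion AllenLocus AllenDyadicCorollary
  AllenDoorSector DyadicDegenerateResidual not_allenLocus_iff largeJResidual_of_sectors allenDoorSector_of_corollary
  residual_of_largeJResidual)
open Summit.Langlands.Langlands.Theorems.TwoDivisionFieldSplit (FullTwoTorsion FullTwoTorsionResidual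
  MixedSignTwoTorsionResidual NegativePlaceSupersingularResidual IrreducibleCMComponentResidual pieces_of_residual
  exists_root_of_fullTwoTorsion)

namespace Summit.Langlands.Langlands.Theorems.OddPrimeDoorSplit

/-! ## §1 The dials at an odd prime `p` (properties of `E[p]`, of `j(E)` and of `K₀` only) -/

/-- DOOR 1 (generic regime): for some `p ∈ {3, 5, 7}`, `ρ̄_{E,p}(G_{K₀(ζ_p)})` is absolutely irreducible — the
hypothesis of Freitas–Le Hung–Siksek 2015, Thms. 3–4, on the tree carrier `ModPImageAbsIrreducibleOverCyclotomic`
(the `Fact p.Prime` instance is the anonymous one built from `hp`). -/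
def Generic357 (K₀ : Type) [Field K₀] [NumberField K₀] (E : WeierstrassCurve (𝓞 K₀)) : Prop :=
  ∃ (p : ℕ) (hp : p.Prime), (p = 3 ∨ p = 5 ∨ p = 7) ∧
    @ModPImageAbsIrreducibleOverCyclotomic K₀ _ (E.baseChange K₀) p ⟨hp⟩

/-- `ρ̄_{E,p}` is absolutely irreducible (for every framing of the Galois action on `(E ⊗ K₀)[p]`). -/
def ModPAbsIrreducible (K₀ : Type) [Field K₀] [NumberField K₀] (E : WeierstrassCurve (𝓞 K₀)) (p : ℕ)
    [Fact p.Prime] : Prop :=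
  ∀ ρ : ModPGaloisRep K₀ (ZMod p) 2, (E.baseChange K₀).IsTorsionGaloisRep p ρ → FramedRep.IsAbsolutelyIrreducible ρ

/-- `E` is potentially multiplicative at every place above `p`: `v(j_E) < 0` for all `v ∣ p` (Mathlib's
multiplicative normalisation of `HeightOneSpectrum.valuation`: `1 < v(j)`).  Then `ρ_{E,p}|_{D_v} ≃ (τε *; 0 τ)`
with `τ` of order `≤ 2` (Tate curve): nearly ordinary in the sense of Skinner–Wiles (5.1)(v). -/
def PotMultAbove (K₀ : Type) [Field K₀] [NumberField K₀] (E : WeierstrassCurve (𝓞 K₀)) (p : ℕ) : Prop :=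
  ∀ v : HeightOneSpectrum (𝓞 K₀), (p : 𝓞 K₀) ∈ v.asIdeal → 1 < v.valuation K₀ (jInv K₀ E)

/-- No completion `K₀ᵥ`, `v ∣ p`, contains a primitive `p`-th root of unity, i.e. `ε̄_p ≠ 1` on every
decomposition group `D_v`, `v ∣ p` — with `PotMultAbove` this is exactly Skinner–Wiles' `D_v`-distinguishedness
of `ρ̄_{E,p}` (semisimplified restriction `τ̄ε̄ ⊕ τ̄` with `τ̄ε̄ ≠ τ̄`). A property of the FIELD `K₀`. -/
def NoLocalMuAbove (K₀ : Type) [Field K₀] [NumberField K₀] (p : ℕ) : Prop :=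
  ∀ v : HeightOneSpectrum (𝓞 K₀), (p : 𝓞 K₀) ∈ v.asIdeal → ¬ ∃ ζ : v.adicCompletion K₀, IsPrimitiveRoot ζ p

/-- THE SKINNER–WILES LOCUS at `p`: `ρ̄_{E,p}` absolutely irreducible, NOT generic at `p` (so — Clifford theory
along the cyclic extension `K₀(ζ_p)/K₀` — `ρ̄_{E,p}` is induced from the quadratic subfield of `K₀(ζ_p)`:
dihedral, the case "that eludes [W], [Dl], [F]" which Skinner–Wiles 2001 §5 covers), potentially multiplicative
above `p`, and `D_v`-distinguished above `p`. -/
def SWLocus (K₀ : Type) [Field K₀] [NumberField K₀] (E : WeierstrassCurve (𝓞 K₀)) (p : ℕ) [Fact p.Prime] : Prop :=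
  ModPAbsIrreducible K₀ E p ∧ ¬ ModPImageAbsIrreducibleOverCyclotomic (E.baseChange K₀) p ∧
    PotMultAbove K₀ E p ∧ NoLocalMuAbove K₀ p

/-- DOOR 2: `E` lies on the Skinner–Wiles locus at some `p ∈ {3, 5, 7}`. -/
def OnSWDoor (K₀ : Type) [Field K₀] [NumberField K₀] (E : WeierstrassCurve (𝓞 K₀)) : Prop :=
  ∃ (p : ℕ) (hp : p.Prime), (p = 3 ∨ p = 5 ∨ p = 7) ∧ @SWLocus K₀ _ _ E p ⟨hp⟩

/-- `p` is TOTALLY SPLIT in `K₀` (typed as in the tree's `Tung2021_hilbertTotallySplit`: `p ∤ d_{K₀}` and every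
residue field above `p` has `p` elements), so `K₀ᵥ = ℚ_p` for all `v ∣ p`. A property of the FIELD `K₀`. -/
def TotallySplitAt (K₀ : Type) [Field K₀] [NumberField K₀] (p : ℕ) : Prop :=
  ¬ ((p : ℤ) ∣ NumberField.discr K₀) ∧ ∀ v : HeightOneSpectrum (𝓞 K₀), (p : 𝓞 K₀) ∈ v.asIdeal → v.residueCard = p

/-- `E` is POTENTIALLY SUPERSINGULAR at every place above `p ∈ {3, 5, 7}`: `v(j_E − j_ss(p)) > 0` for all `v ∣ p`,
where `j_ss(3) = j_ss(5) = 0` and `j_ss(7) = 1728` is the unique supersingular `j`-invariant in characteristic `p`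
(so `v(j) ≥ 0`: potentially good reduction, and the good reduction attained over an extension is supersingular
since `j` reduces to `j_ss`).  For `K₀ᵥ = ℚ_p` this makes `ρ_{E,p}|_{G_{K₀ᵥ}}` absolutely irreducible (no
`ℚ_p`-rational formal CM on a height-2 connected `p`-divisible group). -/
def PotSupersingularAbove (K₀ : Type) [Field K₀] [NumberField K₀] (E : WeierstrassCurve (𝓞 K₀)) (p : ℕ) : Prop :=
  ∀ v : HeightOneSpectrum (𝓞 K₀), (p : 𝓞 K₀) ∈ v.asIdeal →
    v.valuation K₀ (jInv K₀ E - ((if p = 7 then 1728 else 0 : ℕ) : K₀)) < 1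

/-- THE PAN–ZHANG LOCUS at `p`: `p` totally split in `K₀`, `ρ̄_{E,p}` absolutely irreducible (NO condition on
`ρ̄|G_{K₀(ζ_p)}`), `E` potentially supersingular above `p` (so `ρ_{E,p}|_{G_{ℚ_p}}` absolutely irreducible, de Rham,
Hodge–Tate weights `{0,1}`) — the hypotheses of X. Zhang 2024, Thm. 6.1.1 (after Pan 2022) for `ρ_{E,p}`, up to the
residual automorphy of `ρ̄_{E,p}` (off door 1 it is dihedral: automorphic induction). -/
def PZLocus (K₀ : Type) [Field K₀] [NumberField K₀] (E : WeierstrassCurve (𝓞 K₀)) (p : ℕ) [Fact p.Prime] : Prop :=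
  TotallySplitAt K₀ p ∧ ModPAbsIrreducible K₀ E p ∧ PotSupersingularAbove K₀ E p

/-- DOOR 3: `E` lies on the Pan–Zhang locus at some `p ∈ {3, 5, 7}`. -/
def OnPZDoor (K₀ : Type) [Field K₀] [NumberField K₀] (E : WeierstrassCurve (𝓞 K₀)) : Prop :=
  ∃ (p : ℕ) (hp : p.Prime), (p = 3 ∨ p = 5 ∨ p = 7) ∧ @PZLocus K₀ _ _ E p ⟨hp⟩

/-- OFF ALL DOORS: not generic at any of `3, 5, 7`, on no Skinner–Wiles locus and on no Pan–Zhang locus — the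
residual dial. -/
def OffDoors (K₀ : Type) [Field K₀] [NumberField K₀] (E : WeierstrassCurve (𝓞 K₀)) : Prop :=
  ¬ Generic357 K₀ E ∧ ¬ OnSWDoor K₀ E ∧ ¬ OnPZDoor K₀ E

/-! ## §2 The print junctions (doors 2 and 3): Skinner–Wiles 2001 Thm. 5.1 and Pan 2022 / X. Zhang 2024 Thm. 6.1.1, at the torsion primes 3, 5, 7 (E-level) -/

/-- SWD — SKINNER–WILES DIHEDRAL DOOR (print chain, E-level, for EVERY totally real field): an integral `E`
(`Δ ≠ 0`) over a totally real `K` lying on `SWLocus K E p` for some `p ∈ {3,5,7}` is modular.  Print chain: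
(1) `ρ = ρ_{E,p}` satisfies Skinner–Wiles (5.1) [doi:10.5802/afst.988, p. 203]: continuous, irreducible (`E` has no
CM over the totally real `K`), unramified a.e., totally odd, `det ρ = ε` (`k = 2`, `ψ = 1`), nearly ordinary at
each `v ∣ p` (`PotMultAbove`); (2) `ρ̄` is irreducible and `D_v`-distinguished for all `v ∣ p` (`ModPAbsIrreducible`,
`NoLocalMuAbove`); (3) `ρ̄ ≃ Ind χ̄` from the quadratic subfield of `K(ζ_p)` (¬ generic + absolutely irreducible),
so `ρ̄` has the nearly ordinary `χ₂`-good automorphic lift required by Thm. 5.1 (ii): the weight-one theta series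
of the Teichmüller lift of `χ̄` (Hecke; Jacquet–Langlands automorphic induction) moved to weight `≥ 2` inside its
nearly ordinary Hida family (Wiles 1988, Hida 1989); (4) Thm. 5.1 [ibid. p. 204]: `ρ ≃ ρ_π`, hence `E` is
modular (`IsModularEllipticCurve`, trace form).  NOT in the tree (no Skinner–Wiles 2001 fact is vendored; the
tree's `SkinnerWilesDefectOne` concerns the 1999 RESIDUALLY REDUCIBLE theorem): a junction to be vendored as a
named fact + the residual-automorphy lemma (3).  [ref: SkinnerWiles2001, Thm. 5.1] [ref: Wiles1988] -/
def SkinnerWilesDihedralDoor : Prop :=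
  ∀ (K : Type) [Field K] [NumberField K] [IsTotallyReal K] (E : WeierstrassCurve (𝓞 K)), E.Δ ≠ 0 →
    ∀ (p : ℕ) [Fact p.Prime], (p = 3 ∨ p = 5 ∨ p = 7) → SWLocus K E p → IsModularEllipticCurve K E

/-- PZD — PAN–ZHANG SUPERSINGULAR DOOR (print chain, E-level, for every totally real field in which `p` splits
completely): an integral `E` (`Δ ≠ 0`) over a totally real `K` on `PZLocus K E p` for some `p ∈ {3,5,7}` is modular.
Print chain: (1) X. Zhang 2024, Thm. 6.1.1 [arXiv:2412.06812, p. 33] (removing Pan 2022's exceptional shapes at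
`p = 3`): `F` totally real, `p` odd and completely split in `F`, `ρ : G_F → GL₂(𝒪)` continuous irreducible, finitely
ramified, `ρ̄` absolutely irreducible, `ρ|_{G_{F_v}}` absolutely irreducible and de Rham with distinct Hodge–Tate
weights for all `v ∣ p`, totally odd, `ρ̄ ≃ ρ̄_{π₀}` for a regular algebraic cuspidal `π₀` ⇒ `ρ` automorphic — NO
hypothesis on `ρ̄|G_{F(ζ_p)}`; (2) for `ρ = ρ_{E,p}`: finitely ramified, odd, de Rham with weights `{0,1}`, and
`ρ|_{G_{ℚ_p}}` absolutely irreducible on `PotSupersingularAbove` with `K_v = ℚ_p`; (3) residual automorphy: on door 1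
by FLS, off door 1 `ρ̄ ≃ Ind χ̄` from the quadratic subfield `K₁` of `K(ζ_p)` — for `p = 3, 7` `K₁ = K(√-3), K(√-7)`
is CM and `π₀ = AI(ψ)` for an algebraic Hecke character `ψ` of `K₁` lifting `χ̄` (tree: `PatrikisRegularInductionCM`);
for `p = 5` `K₁ = K(√5)` is real and `π₀` is a regular-weight congruence lift of the weight-one theta series
(Hasse invariant / `p`-power level, Taylor 1989 §1).  NOT in the tree (no Pan 2022 / Zhang 2024 fact for Hilbert
modular forms beyond the `Tung2021_hilbertTotallySplit` pattern, which carries the `F(ζ_p)` hypothesis).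
[ref: XZhang2024, Thm. 6.1.1] [ref: Pan2022, Thm. 1.0.2] -/
def PanZhangSupersingularDoor : Prop :=
  ∀ (K : Type) [Field K] [NumberField K] [IsTotallyReal K] (E : WeierstrassCurve (𝓞 K)), E.Δ ≠ 0 →
    ∀ (p : ℕ) [Fact p.Prime], (p = 3 ∨ p = 5 ∨ p = 7) → PZLocus K E p → IsModularEllipticCurve K E

/-! ## §3 The pieces: the two door sectors (closed modulo the junctions) and the residual cores -/

/-- GEN — the generic sector of RES (CLOSED from `FLS2015_theorems3_4` by name: `genericSector_closed`). -/
def GenericSector : Prop :=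
  ∀ (K₀ : Type) [Field K₀] [NumberField K₀], UnanchoredBox K₀ →
    ∀ E : WeierstrassCurve (𝓞 K₀), E.Δ ≠ 0 → InResidualRange K₀ E → ¬ AllenLocus K₀ E → Generic357 K₀ E →
      IsModularEllipticCurve K₀ E

/-- SW — the Skinner–Wiles sector of RES (CLOSED from `SkinnerWilesDihedralDoor`: `swSector_closed`). -/
def SWSector : Prop :=
  ∀ (K₀ : Type) [Field K₀] [NumberField K₀], UnanchoredBox K₀ →
    ∀ E : WeierstrassCurve (𝓞 K₀), E.Δ ≠ 0 → InResidualRange K₀ E → ¬ AllenLocus K₀ E → OnSWDoor K₀ E →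
      IsModularEllipticCurve K₀ E

/-- PZ — the Pan–Zhang sector of RES (CLOSED from `PanZhangSupersingularDoor`: `pzSector_closed`). -/
def PZSector : Prop :=
  ∀ (K₀ : Type) [Field K₀] [NumberField K₀], UnanchoredBox K₀ →
    ∀ E : WeierstrassCurve (𝓞 K₀), E.Δ ≠ 0 → InResidualRange K₀ E → ¬ AllenLocus K₀ E → OnPZDoor K₀ E →
      IsModularEllipticCurve K₀ E

/-- EXC — the exceptional range of RES (off door 1 only; the lens's "finite range": `j(E)` on one of the 27 FLS
curves `X(u,v,w)`).  EXC ⟸ SWD ∧ PZD ∧ CoreResidual (`exceptional_of_core`). -/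
def ExceptionalResidual : Prop :=
  ∀ (K₀ : Type) [Field K₀] [NumberField K₀], UnanchoredBox K₀ →
    ∀ E : WeierstrassCurve (𝓞 K₀), E.Δ ≠ 0 → InResidualRange K₀ E → ¬ AllenLocus K₀ E → ¬ Generic357 K₀ E →
      IsModularEllipticCurve K₀ E

/-- CORE — THE DECLARED RESIDUAL of this node: RES off all three doors (IDEA-NEEDED; no print: at EACH of 3, 5, 7 the
mod-`p` image is Borel / Cartan-normaliser valued (finitely many `j` per field: the 27 FLS curves `X(u,v,w)`) AND the
curve misses both the Skinner–Wiles locus (not potentially multiplicative above `p`, or `μ_p ⊂ K₀ᵥ` somewhere, or `ρ̄`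
not absolutely irreducible) and the Pan–Zhang locus (`p` not totally split in `K₀`, or not potentially supersingular
above `p`, or `ρ̄` not absolutely irreducible) — e.g. residually Borel at 3 with `K₀(φ̄₁/φ̄₂)/ℚ` non-abelian, or
dihedral and potentially good ordinary / mixed above `p`). -/
def CoreResidual : Prop :=
  ∀ (K₀ : Type) [Field K₀] [NumberField K₀], UnanchoredBox K₀ →
    ∀ E : WeierstrassCurve (𝓞 K₀), E.Δ ≠ 0 → InResidualRange K₀ E → ¬ AllenLocus K₀ E → OffDoors K₀ E →
      IsModularEllipticCurve K₀ E

/-- F2T_core — g29's F2T (`FullTwoTorsionResidual`: full rational `2`-torsion) off all three doors. -/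
def FullTwoTorsionCore : Prop :=
  ∀ (K₀ : Type) [Field K₀] [NumberField K₀], UnanchoredBox K₀ →
    ∀ E : WeierstrassCurve (𝓞 K₀), E.Δ ≠ 0 → InResidualRange K₀ E → FullTwoTorsion K₀ E → OffDoors K₀ E →
      IsModularEllipticCurve K₀ E

/-- R₂⁻_core — g29's R₂⁻ (`MixedSignTwoTorsionResidual`) off all three doors. -/
def MixedSignTwoTorsionCore : Prop :=
  ∀ (K₀ : Type) [Field K₀] [NumberField K₀], UnanchoredBox K₀ →
    ∀ E : WeierstrassCurve (𝓞 K₀), E.Δ ≠ 0 → InResidualRange K₀ E →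
      (∃ x : K₀, ((E.baseChange K₀).twoTorsionPolynomial).toPoly.IsRoot x) →
      (∃ σ : K₀ →+* ℝ, σ (disc K₀ E) < 0) → OffDoors K₀ E → IsModularEllipticCurve K₀ E

/-- R_ss⁻_core — g29's R_ss⁻ (`NegativePlaceSupersingularResidual`) off all three doors. -/
def NegativePlaceSupersingularCore : Prop :=
  ∀ (K₀ : Type) [Field K₀] [NumberField K₀], UnanchoredBox K₀ →
    ∀ E : WeierstrassCurve (𝓞 K₀), E.Δ ≠ 0 → InResidualRange K₀ E → NoRationalTwoTorsion K₀ E →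
      (∃ v : HeightOneSpectrum (𝓞 K₀), (2 : 𝓞 K₀) ∈ v.asIdeal ∧ v.valuation K₀ (jInv K₀ E) < 1) →
      (∃ σ : K₀ →+* ℝ, σ (disc K₀ E) < 0) → OffDoors K₀ E → IsModularEllipticCurve K₀ E

/-- R_cm⁶_core — g29's R_cm⁶ (`IrreducibleCMComponentResidual`) off all three doors. -/
def IrreducibleCMComponentCore : Prop :=
  ∀ (K₀ : Type) [Field K₀] [NumberField K₀], UnanchoredBox K₀ →
    ∀ E : WeierstrassCurve (𝓞 K₀), E.Δ ≠ 0 → InResidualRange K₀ E → NoRationalTwoTorsion K₀ E →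
      (∀ σ : K₀ →+* ℝ, σ (disc K₀ E) < 0) →
      (∀ v : HeightOneSpectrum (𝓞 K₀), (2 : 𝓞 K₀) ∈ v.asIdeal →
        IsSquare (algebraMap K₀ (v.adicCompletion K₀) (disc K₀ E))) →
      OffDoors K₀ E → IsModularEllipticCurve K₀ E

end Summit.Langlands.Langlands.Theorems.OddPrimeDoorSplit
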